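import Summits.ResolutionOfSingularities.ResolutionOfSingularities.Theorems.FrobeniusClosingPatchingRelPerfectConeDepthTwoLevelTwo
import Summits.ResolutionOfSingularities.ResolutionOfSingularities.Theorems.FrobeniusClosingPatchingRelPerfectCoreRungConeMember
import Literature.AlgebraicGeometry.Resolution.BlowupPointSubalgebra
import HarnessLib

/-!
# Crux `PatchingRelPerfect` (stmt-ResolutionOfSingularities-16161), chain w52 — R4ˢ INSTANCE:
# the quadric-CONE member AT EXCEPTIONAL DEPTH TWO, `(x₀x₁ + x₂²) + 𝔪⁴ ∈ 𝒞`, kernel-checked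

[OURS · L1 W5.2 · rung] The depth-two analogue of rung r2pt, the first member with SINGULAR initial
scheme and exceptional depth `ℓ = 2` (CHAIN.md v1.5 §3 «NOT covered: two-layer one-form with
singular initial scheme (→ R4)»; plan-1 g6 STEER 2026-08-27T04:50:53Z: singleton depth-two rung R4ˢ).
`S` regular local with regular system of parameters `x₀, …, x₃` (EVERY characteristic, EVERY
residue field, no completeness), `q = x₀x₁ + x₂²`, `I = (q) + 𝔪⁴`.  Companion
`Q = (P + 𝔪²)(I + 𝔪²(P + 𝔪²)) · 𝔪`, `P = (x₀, x₁, x₂)`; `Bl_{I·Q} Spec S` is the tower of REGULAR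
centres `Bl_𝔪 ← Bl_{z₀} ← Bl_{C̃} ← Bl_{C̃'}` (identities: `…ConeDepthTwoCharts.lean`).  The
mechanism is the depth-two dictionary of CHAIN §1 (A): one weight-two-PERMISSIBLE point blow-up
(`K = (q̃, u²) ≤ 𝔫_{z₀}²`) lowers the order of the residual to one, and the order-one residual
`(h) + (u'²)` — `h` the strict transform of the cone, a LOCAL hypersurface of maximal contact —
finishes by the two-step Euclidean tower of stub-1's `isRegular_of_isBlowup_tower` along the pair
`(u', h)`, whose quasi-regularity on the point-blow-up charts is `…ChartStrictExceptional.lean`.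
Level two (the vertex blow-up, abstract regular base) is `…ConeDepthTwoLevelTwo.lean`.  PROVED here:

* level one: `F_notMem_span_u` (`F ∉ (u)` on every chart), `isRegular_of_isBlowup_map_I2Q_of_ne_three`
  (charts `x₀, x₁, x₂`: the tower for `(u, F)` at once), `isRegular_of_isBlowup_map_I2Q_three`
  (the vertex chart), `isRegular_of_isBlowup_I2QM`;
* the rung: `companion_cone_sup_pow_four` (`(q) + 𝔪⁴ ∈ 𝒞`, companion `⊇ 𝔪⁷`),
  `coreRung_cone_sup_pow_four`, `coreRung_fourthPowersPlus_cone` (`(x₀⁴, …, x₃⁴, q)`, a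
  sup-reduction), `coreRung_fourthPowersPlus_cone_of_ringKrullDim` (TargetR2pt binder shape) and
  `atomDimFourBlowupAt_fourthPowersPlus_cone` (the registered core's binder shape on the member).

BC5-type FORMAT evidence for rung R4ˢ; nothing here is a statement of the manuscript under review.

## References

* The Stacks Project, Tags 080A, 080B, 0804, 07Z3, 0BIQ. [StacksProject]
* Q. Liu, *Algebraic Geometry and Arithmetic Curves*, OUP 2002, Thm. 8.1.19 (a). [Liu2002]
* H. Matsumura, *Commutative Ring Theory*, CUP 1986, Thms. 14.2, 16.2, 16.3. [Matsumura1987]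
* J. Kollár, *Lectures on Resolution of Singularities*, PUP 2007, (3.111) Step 3. [Kollar2007]
-/

-- `Summit.<Summit>.<Sub>.Theorems` with `Sub = Summit` (single-conjunct summit, D-0017)
set_option linter.dupNamespace false

noncomputable section

open CategoryTheory CategoryTheory.Limits AlgebraicGeometry Literature.AlgebraicGeometry.Resolution
open IsLocalRing

namespace Summit.ResolutionOfSingularities.ResolutionOfSingularities.Theorems

namespace ConeRung

universe u


/-! ## Level one over a regular local base -/

section LevelOneRegular

variable {S : Type u} [CommRing S] [IsRegularLocalRing S] (x : Fin 4 → S)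
  (hx : Ideal.span (Set.range x) = IsLocalRing.maximalIdeal S)
  (hd : (IsLocalRing.maximalIdeal S).spanFinrank = 4)

local notation3 "M" => Ideal.span (Set.range x)
local notation3 "I2" => Ideal.span {x 0 * x 1 + x 2 ^ 2} ⊔ Ideal.span (Set.range x) ^ 4
local notation3 "PP" => Ideal.span {x 0, x 1, x 2}
local notation3 "QQ2" => (PP ⊔ M ^ 2) * (I2 ⊔ M ^ 2 * (PP ⊔ M ^ 2))
/-- the vertex-chart family index `k ↦ castSucc k ≠ 3` -/
local notation3 "jJ3" =>
  (fun k : Fin 3 => (⟨Fin.castSucc k, castSucc_ne_three k⟩ : {j : Fin 4 // j ≠ 3}))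

/-! ### `F ∉ (u)` on every chart: the initial form `T₀T₁ + T₂²` does not vanish identically on
any standard affine piece of `E ≅ ℙ³` -/

include hx hd in
/-- **`F = e₀e₁ + e₂² ∉ (u)` on every Rees chart `B_i`**: under `B_i/(u) ≅ κ[T_j : j ≠ i]` the
class of `F` is `T₀T₁ + T₂²` with `T_i := 1`, a non-zero polynomial (it has a non-zero value at a
`κ`-point). [cite: StacksProject, Tag 0BIQ] -/
theorem F_notMem_span_u (i : Fin 4) :
    chartGen x i 0 * chartGen x i 1 + chartGen x i 2 ^ 2 ∉ Ideal.span {chartBase x i (x i)} := by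
  haveI := isMaximal_span_rsop x hx
  letI := Ideal.Quotient.field (M)
  have hqr := isQuasiRegular_regularSystemOfParameters hd x hx
  set ε := chartQuotEquiv x i hqr with hε
  -- evaluation at the `κ`-point `T₂ = 1`, `T_j = 0` otherwise
  set θ : (chartRing x i ⧸ Ideal.span {chartBase x i (x i)}) →+* S ⧸ M :=
    (MvPolynomial.eval fun j : {j : Fin 4 // j ≠ i} => if j.1 = (2 : Fin 4) then (1 : S ⧸ M) else 0).comp
      ε.symm.toRingHom with hθ
  have hθdef : ∀ z, θ z = MvPolynomial.eval
      (fun j : {j : Fin 4 // j ≠ i} => if j.1 = (2 : Fin 4) then (1 : S ⧸ M) else 0) (ε.symm z) :=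
    fun z => rfl
  have hθX : ∀ (j : Fin 4) (hj : j ≠ i),
      θ (Ideal.Quotient.mk _ (chartGen x i j)) = if j = 2 then 1 else 0 := fun j hj => by
    have h1 : ε.symm (Ideal.Quotient.mk _ (chartGen x i j)) = MvPolynomial.X ⟨j, hj⟩ := by
      rw [RingEquiv.symm_apply_eq, hε, chartQuotEquiv_apply, chartQuotMap_X]
    rw [hθdef, h1, MvPolynomial.eval_X]
  have hθi : θ (Ideal.Quotient.mk _ (chartGen x i i)) = 1 := by
    rw [show chartGen x i i = 1 from chartGen_self x i, map_one, map_one]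
  have hθ2 : θ (Ideal.Quotient.mk _ (chartGen x i 2)) = 1 := by
    by_cases h2 : (2 : Fin 4) = i
    · subst h2; exact hθi
    · rw [hθX 2 h2, if_pos rfl]
  have hθ01 : θ (Ideal.Quotient.mk _ (chartGen x i 0)) *
      θ (Ideal.Quotient.mk _ (chartGen x i 1)) = 0 := by
    by_cases h0 : (0 : Fin 4) = i
    · subst h0
      rw [hθX 1 one_ne_zero4, if_neg (by decide), mul_zero]
    · rw [hθX 0 h0, if_neg (by decide), zero_mul]
  intro hmem
  have h0 : Ideal.Quotient.mk (Ideal.span {chartBase x i (x i)})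
      (chartGen x i 0 * chartGen x i 1 + chartGen x i 2 ^ 2) = 0 :=
    Ideal.Quotient.eq_zero_iff_mem.mpr hmem
  have h := congrArg θ h0
  simp only [map_add, map_mul, map_pow, map_zero] at h
  rw [hθ01, hθ2, one_pow, zero_add] at h
  exact one_ne_zero h

include hx hd in
/-- `e_j ∉ (u)` for `j ≠ i` (a variable of `κ[T]`). [cite: StacksProject, Tag 0BIQ] -/
theorem chartGen_notMem_span_u (i j : Fin 4) (hj : j ≠ i) :
    chartGen x i j ∉ Ideal.span {chartBase x i (x i)} := by
  haveI := isMaximal_span_rsop x hx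
  have hqr := isQuasiRegular_regularSystemOfParameters hd x hx
  intro h
  have hX : chartQuotEquiv x i hqr (MvPolynomial.X ⟨j, hj⟩) =
      Ideal.Quotient.mk (Ideal.span {chartBase x i (x i)}) (chartGen x i j) := by
    rw [chartQuotEquiv_apply, chartQuotMap_X]
  rw [Ideal.Quotient.eq_zero_iff_mem.mpr h, map_eq_zero_iff _ (chartQuotEquiv x i hqr).injective]
    at hX
  exact MvPolynomial.X_ne_zero _ hX

/-! ### The charts `x₀, x₁, x₂`: the two-step tower for `(u, F)` -/

include hx hd in
/-- **On the charts `i = 0, 1, 2` every blow-up of `Spec B_i` along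
`(I Q) B_i = u⁵ · (u, F) · ((F) + (u²))` is regular**: `(u, F)` is a weakly regular pair with
regular quotient (`B_i/(u)` a domain, `F ∉ (u)`; `…ConeMemberLevelOne`), so the two-step tower
applies. [cite: Liu2002, Thm. 8.1.19 (a)] [cite: StacksProject, Tag 080A] -/
theorem isRegular_of_isBlowup_map_I2Q_of_ne_three (i : Fin 4) (hi : i ≠ 3) {Y : Scheme.{u}}
    {ρ : Y ⟶ Spec (.of (chartRing x i))}
    (hρ : IsBlowup ρ (affineBlowup.idealSheaf ((I2 * QQ2).map (chartBase x i)))) :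
    Scheme.IsRegular Y := by
  haveI := isRegularRing_chart x hx hd i
  haveI := isDomain_residue x hx
  have hqr := isQuasiRegular_regularSystemOfParameters hd x hx
  haveI := isDomain_chartRing_quot_span x i hqr
  set x' : Fin 2 → chartRing x i := Fin.cons (chartBase x i (x i))
    (fun _ : Fin 1 => chartGen x i 0 * chartGen x i 1 + chartGen x i 2 ^ 2) with hx'def
  have hx' : IsQuasiRegular x' :=
    isQuasiRegular_of_isWeaklyRegular _ (CoreRungTower.isWeaklyRegular_pair_of_notMem
      (reesChartBase_mem_nonZeroDivisors (x i) (Ideal.mem_span_range_self (f := x) (x := i)))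
      (F_notMem_span_u x hx hd i))
  have hR' : IsRegularRing (chartRing x i ⧸ Ideal.span (Set.range x')) := by
    have h : Ideal.span (Set.range x') = Ideal.span {chartBase x i (x i),
        chartGen x i 0 * chartGen x i 1 + chartGen x i 2 ^ 2} := by
      rw [hx'def, Fin.range_cons (chartBase x i (x i))
        (fun _ : Fin 1 => chartGen x i 0 * chartGen x i 1 + chartGen x i 2 ^ 2), Set.range_const]
    rw [h]
    fin_cases i
    · exact isRegularRing_quot_span_u_F_zero x hx hd
    · exact isRegularRing_quot_span_u_F_one x hx hd
    · exact isRegularRing_quot_span_u_F_two x hx hd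
    · exact absurd rfl hi
  have hu5 : chartBase x i (x i) ^ 5 ∈ nonZeroDivisors (chartRing x i) :=
    pow_mem (reesChartBase_mem_nonZeroDivisors (x i)
      (Ideal.mem_span_range_self (f := x) (x := i))) 5
  rw [map_chartBase_I2Q_of_ne_three x i hi, ← CoreRungTower.towerTwo_eq] at hρ
  exact CoreRungTower.isRegular_of_isBlowup_span_singleton_mul hu5 _
    (fun Y' ρ' h' => isRegular_of_isBlowup_tower 2 x' (fun _ : Fin 1 => (1 : Fin 2))
      (Function.injective_of_subsingleton _) hx' hR' h') hρ

/-! ### The vertex chart `x₃`: instantiate level two with `A = B₃` -/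

include hx hd in
/-- **The vertex chart: every blow-up of `Spec B₃` along `(I Q) B₃ = u⁵ · (L · K) · 𝔫₀` is
regular** — the abstract level two with `A = B₃`, `t = u`, `v_k = e_k`.
[cite: StacksProject, Tag 080A] [cite: Liu2002, Thm. 8.1.19 (a)] -/
theorem isRegular_of_isBlowup_map_I2Q_three {Y : Scheme.{u}}
    {ρ : Y ⟶ Spec (.of (chartRing x 3))}
    (hρ : IsBlowup ρ (affineBlowup.idealSheaf ((I2 * QQ2).map (chartBase x 3)))) :
    Scheme.IsRegular Y := by
  haveI : IsDomain S := isDomain_of_isRegularLocalRing S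
  have hqr := isQuasiRegular_regularSystemOfParameters hd x hx
  haveI : IsRegularRing (chartRing x 3) := isRegularRing_chart x hx hd 3
  haveI := isRegularRing_residue x hx
  haveI := isDomain_residue x hx
  have hx3 : x 3 ≠ 0 := (isRsopPart_comp_of_rsop hd x hx id Function.injective_id).ne_zero 3
  haveI : IsDomain (chartRing x 3) := isDomain_chartRing x 3 hx3
  haveI : IsRegularRing (chartRing x 3 ⧸ Ideal.span (Set.range
      (Fin.cons (chartBase x 3 (x 3)) (fun k : Fin 3 => chartGen x 3 (jJ3 k).1) :
        Fin 4 → chartRing x 3))) :=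
    isRegularRing_quot_cons_chartGen x 3 jJ3 hqr
  haveI : IsDomain (chartRing x 3 ⧸ Ideal.span (Set.range
      (Fin.cons (chartBase x 3 (x 3)) (fun k : Fin 3 => chartGen x 3 (jJ3 k).1) :
        Fin 4 → chartRing x 3))) :=
    isDomain_quot_span_range_cc x hx hd
  haveI : IsDomain (chartRing x 3 ⧸ Ideal.span {chartBase x 3 (x 3)}) :=
    isDomain_chartRing_quot_span x 3 hqr
  have hc : IsQuasiRegular (Fin.cons (chartBase x 3 (x 3))
      (fun k : Fin 3 => chartGen x 3 (jJ3 k).1) : Fin 4 → chartRing x 3) :=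
    isQuasiRegular_cons_chartGen x 3 jJ3 hqr jJ3_injective
  have hv : ∀ k : Fin 3, chartGen x 3 (jJ3 k).1 ∉ Ideal.span {chartBase x 3 (x 3)} :=
    fun k => chartGen_notMem_span_u x hx hd 3 _ (castSucc_ne_three k)
  have hFt := F_notMem_span_u x hx hd 3
  have hreg1 : ∀ (k : Fin 3) (P : Ideal (chartRing x 3 ⧸ Ideal.span {chartBase x 3 (x 3),
      chartGen x 3 0 * chartGen x 3 1 + chartGen x 3 2 ^ 2})) [P.IsPrime],
      Ideal.Quotient.mk _ (chartGen x 3 (Fin.castSucc k)) ∉ P →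
        IsRegularLocalRing (Localization.AtPrime P) :=
    fun k P _ hP => isRegularLocalRing_quot_span_u_F_three x hx hd P k hP
  rw [map_chartBase_I2Q] at hρ
  have hu5 : chartBase x 3 (x 3) ^ 5 ∈ nonZeroDivisors (chartRing x 3) :=
    pow_mem (reesChartBase_mem_nonZeroDivisors (x 3)
      (Ideal.mem_span_range_self (f := x) (x := 3))) 5
  exact isRegular_of_isBlowup_span_singleton_mul_of_forall hu5 _
    (fun Y' ρ' h' => isRegular_of_isBlowup_LK_mul_span (chartBase x 3 (x 3))
      (fun k : Fin 3 => chartGen x 3 (jJ3 k).1) hc hv hFt hreg1 h') hρ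

include hx hd in
/-- **Every blowing up of `Spec S` along `I · Q · 𝔪` is regular** — `Bl_𝔪` and the four charts.
[cite: StacksProject, Tag 080A] [cite: Liu2002, Thm. 8.1.19 (a)] -/
theorem isRegular_of_isBlowup_I2QM {Y : Scheme.{u}} {f : Y ⟶ Spec (.of S)}
    (hf : IsBlowup f (affineBlowup.idealSheaf ((I2 * QQ2) * M))) : Scheme.IsRegular Y := by
  refine isRegular_of_isBlowup_mul_of_charts x (I2 * QQ2) (fun i Y' ρ h => ?_) hf
  by_cases hi : i = 3
  · subst hi
    exact isRegular_of_isBlowup_map_I2Q_three x hx hd h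
  · exact isRegular_of_isBlowup_map_I2Q_of_ne_three x hx hd i hi h

include hx hd in
/-- **`I = (q) + 𝔪⁴` is in the companion class `𝒞`** with companion `Q · 𝔪 ⊇ 𝔪⁷`.
[cite: StacksProject, Tag 080A] -/
theorem companion_cone_sup_pow_four :
    ∃ (Q : Ideal S) (m : ℕ), IsLocalRing.maximalIdeal S ^ m ≤ Q ∧
      ∃ (Y : Scheme.{u}) (b : Y ⟶ Spec (.of S)),
        IsBlowup b (affineBlowup.idealSheaf ((I2) * Q)) ∧ Scheme.IsRegular Y := by
  obtain ⟨Y, b, hb⟩ := exists_isBlowup (Spec (.of S)) (affineBlowup.idealSheaf ((I2 * QQ2) * M))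
  refine ⟨QQ2 * M, 7, ?_, Y, b, by rwa [← mul_assoc], isRegular_of_isBlowup_I2QM x hx hd hb⟩
  rw [← hx, show (7 : ℕ) = 2 + (2 + 2) + 1 from rfl, pow_add, pow_add, pow_add, pow_one]
  exact Ideal.mul_mono (Ideal.mul_mono le_sup_right
    ((Ideal.mul_mono le_rfl le_sup_right).trans le_sup_right)) le_rfl

include hx hd in
/-- **CORE RUNG R4ˢ-instance — the quadric cone at exceptional depth two.**  For `S` regular
local with regular system of parameters `x₀, …, x₃` and `I = (x₀x₁ + x₂²) + 𝔪⁴`, every blowing up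
`T = Bl_I Spec S` carries a non-zero ideal sheaf cosupported in the closed fibre whose blowing up
is regular.  Every characteristic, every residue field. [cite: StacksProject, Tag 080A]
[cite: Liu2002, Thm. 8.1.19 (a)] -/
theorem coreRung_cone_sup_pow_four (T : Scheme.{u}) (f : T ⟶ Spec (.of S))
    (hf : IsBlowup f (affineBlowup.idealSheaf
      (Ideal.span {x 0 * x 1 + x 2 ^ 2} ⊔ IsLocalRing.maximalIdeal S ^ 4))) :
    ∃ (J : T.IdealSheafData) (T' : Scheme.{u}) (π : T' ⟶ T), J ≠ ⊥ ∧
      (∀ t : T, t ∈ J.support → f.base t = IsLocalRing.closedPoint S) ∧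
      IsBlowup π J ∧ Scheme.IsRegular T' := by
  haveI : IsDomain S := isDomain_of_isRegularLocalRing S
  have hx0 : x 0 ≠ 0 := (isRsopPart_comp_of_rsop hd x hx id Function.injective_id).ne_zero 0
  have h𝔪 : IsLocalRing.maximalIdeal S ≠ ⊥ := fun h => hx0 (by
    have := hx.le (Ideal.subset_span (Set.mem_range_self 0)); rw [h] at this
    exact (Submodule.mem_bot S).mp this)
  have hI : (I2) ≠ ⊥ := fun h => pow_ne_zero 4 h𝔪 (by
    rw [← hx]; exact eq_bot_iff.mpr (le_sup_right.trans h.le))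
  have hQ : IsLocalRing.maximalIdeal S ^ 6 ≤ QQ2 := by
    rw [← hx, show (6 : ℕ) = 2 + (2 + 2) from rfl, pow_add, pow_add]
    exact Ideal.mul_mono le_sup_right ((Ideal.mul_mono le_rfl le_sup_right).trans le_sup_right)
  rw [← hx] at hf
  exact atomConclusion_of_pointBlowup_charts x hx h𝔪 hI hQ (fun i Y' ρ h => by
    by_cases hi : i = 3
    · subst hi
      exact isRegular_of_isBlowup_map_I2Q_three x hx hd h
    · exact isRegular_of_isBlowup_map_I2Q_of_ne_three x hx hd i hi h) T f hf

include hx hd in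
/-- **The Frobenius-shaped variant `(x₀⁴, x₁⁴, x₂⁴, x₃⁴, x₀x₁ + x₂²)`** — a sup-reduction of
`(q) + 𝔪⁴` (`(xᵢ⁴) · 𝔪¹² = 𝔪¹⁶`, r1a's pigeonhole; r1d `coreRung_sup_reduction_of_companion`).
[cite: StacksProject, Tag 080A] [cite: Liu2002, Thm. 8.1.19 (a)] -/
theorem coreRung_fourthPowersPlus_cone (T : Scheme.{u}) (f : T ⟶ Spec (.of S))
    (hf : IsBlowup f (affineBlowup.idealSheaf
      (Ideal.span (Set.range (fun i : Fin 4 => x i ^ 4) ∪ {x 0 * x 1 + x 2 ^ 2})))) :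
    ∃ (J : T.IdealSheafData) (T' : Scheme.{u}) (π : T' ⟶ T), J ≠ ⊥ ∧
      (∀ t : T, t ∈ J.support → f.base t = IsLocalRing.closedPoint S) ∧
      IsBlowup π J ∧ Scheme.IsRegular T' := by
  haveI : IsDomain S := isDomain_of_isRegularLocalRing S
  have hx0 : x 0 ≠ 0 := (isRsopPart_comp_of_rsop hd x hx id Function.injective_id).ne_zero 0
  -- the pigeonhole `(xᵢ⁴) · 𝔪¹² = 𝔪¹⁶`
  have hred :
      Ideal.span (Set.range fun i : Fin 4 => x i ^ 4) * (M ^ 4) ^ 3 = (M ^ 4) ^ (3 + 1) := by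
    rw [← pow_mul, ← pow_mul, CoreRung.span_powers_mul_pow_eq_pow x rfl (by norm_num)]
  have hle : Ideal.span (Set.range fun i : Fin 4 => x i ^ 4) ≤ M ^ 4 := by
    rw [Ideal.span_le]
    rintro _ ⟨i, rfl⟩
    exact Ideal.pow_mem_pow (Ideal.subset_span (Set.mem_range_self i)) 4
  have hI :
      Ideal.span {x 0 * x 1 + x 2 ^ 2} ⊔ Ideal.span (Set.range fun i : Fin 4 => x i ^ 4) ≠ ⊥ :=
    fun h => pow_ne_zero 4 hx0 ((Submodule.eq_bot_iff _).mp h _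
      (Ideal.mem_sup_right (Ideal.subset_span
        (Set.mem_range_self (f := fun i : Fin 4 => x i ^ 4) 0))))
  have hKm : IsLocalRing.maximalIdeal S ^ 4 ≤ I2 := by rw [← hx]; exact le_sup_right
  rw [Ideal.span_union, sup_comm] at hf
  exact coreRung_sup_reduction_of_companion hle hred hI hKm (companion_cone_sup_pow_four x hx hd)
    T f hf

end LevelOneRegular

/-- **The `TargetR2pt` binder shape** (plan-1's `ChainW52TargetsC.lean`): dimension given as
`ringKrullDim S = 4` with a generating family `x` of length `4`.
[cite: StacksProject, Tag 080A] [cite: Liu2002, Thm. 8.1.19 (a)] -/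
theorem coreRung_fourthPowersPlus_cone_of_ringKrullDim {S : Type u} [CommRing S]
    [IsRegularLocalRing S] (x : Fin 4 → S)
    (hx : Ideal.span (Set.range x) = IsLocalRing.maximalIdeal S)
    (hdim : ringKrullDim S = (4 : ℕ)) (T : Scheme.{u}) (f : T ⟶ Spec (.of S))
    (hf : IsBlowup f (affineBlowup.idealSheaf
      (Ideal.span (Set.range (fun i : Fin 4 => x i ^ 4) ∪ {x 0 * x 1 + x 2 ^ 2})))) :
    ∃ (J : T.IdealSheafData) (T' : Scheme.{u}) (π : T' ⟶ T), J ≠ ⊥ ∧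
      (∀ t : T, t ∈ J.support → f.base t = IsLocalRing.closedPoint S) ∧
      IsBlowup π J ∧ Scheme.IsRegular T' := by
  have hd : (IsLocalRing.maximalIdeal S).spanFinrank = 4 := by
    have h := IsRegularLocalRing.spanFinrank_maximalIdeal (R := S)
    rw [hdim] at h
    exact_mod_cast h
  exact coreRung_fourthPowersPlus_cone x hx hd T f hf

/-- **The same for `(q) + 𝔪⁴` in the `ringKrullDim` binder shape.** [cite: StacksProject, Tag 080A] -/
theorem coreRung_cone_sup_pow_four_of_ringKrullDim {S : Type u} [CommRing S]
    [IsRegularLocalRing S] (x : Fin 4 → S)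
    (hx : Ideal.span (Set.range x) = IsLocalRing.maximalIdeal S)
    (hdim : ringKrullDim S = (4 : ℕ)) (T : Scheme.{u}) (f : T ⟶ Spec (.of S))
    (hf : IsBlowup f (affineBlowup.idealSheaf
      (Ideal.span {x 0 * x 1 + x 2 ^ 2} ⊔ IsLocalRing.maximalIdeal S ^ 4))) :
    ∃ (J : T.IdealSheafData) (T' : Scheme.{u}) (π : T' ⟶ T), J ≠ ⊥ ∧
      (∀ t : T, t ∈ J.support → f.base t = IsLocalRing.closedPoint S) ∧
      IsBlowup π J ∧ Scheme.IsRegular T' := by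
  have hd : (IsLocalRing.maximalIdeal S).spanFinrank = 4 := by
    have h := IsRegularLocalRing.spanFinrank_maximalIdeal (R := S)
    rw [hdim] at h
    exact_mod_cast h
  exact coreRung_cone_sup_pow_four x hx hd T f hf

/-- **The registered core's binder shape, restricted to the member** (hypotheses of
`stub_atomDimFourBlowup`; characteristic, completeness, residue field and the off-fibre hypothesis
unused). [cite: StacksProject, Tag 080A] [cite: Liu2002, Thm. 8.1.19 (a)] -/
theorem atomDimFourBlowupAt_fourthPowersPlus_cone (p : ℕ) (_hp : p.Prime) (S : Type) [CommRing S]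
    [IsRegularLocalRing S] [CharP S p] [IsAdicComplete (IsLocalRing.maximalIdeal S) S]
    [PerfectField (IsLocalRing.ResidueField S)] (hS : ringKrullDim S = (4 : ℕ))
    (x : Fin 4 → S) (hx : Ideal.span (Set.range x) = IsLocalRing.maximalIdeal S)
    (T : Scheme.{0}) (f : T ⟶ Spec (.of S))
    (hf : IsBlowup f (affineBlowup.idealSheaf
      (Ideal.span (Set.range (fun j : Fin 4 => x j ^ 4) ∪ {x 0 * x 1 + x 2 ^ 2}))))
    (_hoff : ∀ t : T, f.base t ≠ IsLocalRing.closedPoint S →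
      IsRegularLocalRing (T.presheaf.stalk t)) :
    ∃ (J : T.IdealSheafData) (T' : Scheme.{0}) (π : T' ⟶ T), J ≠ ⊥ ∧
      (∀ t : T, t ∈ J.support → f.base t = IsLocalRing.closedPoint S) ∧
      IsBlowup π J ∧ Scheme.IsRegular T' :=
  coreRung_fourthPowersPlus_cone_of_ringKrullDim x hx hS T f hf

end ConeRung

end Summit.ResolutionOfSingularities.ResolutionOfSingularities.Theorems

end
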